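import Literature.AnabelianGeometry.Anabelioids.FreeObjects
import Literature.AnabelianGeometry.Anabelioids.FreeFibres
import Literature.AnabelianGeometry.Anabelioids.FiberRealization
import Mathlib.Data.Finite.Perm
import HarnessLib

/-!
# Anabelioids: products with an object whose stabilisers act trivially ([SemiAnbd] proof of Prop. 2.5)

Mochizuki, *Semi-graphs of anabelioids*, Publ. RIMS **42** (2006), §2, proof of Proposition 2.5 (i),
author's manuscript p. 27 [cite: MochizukiSemiAnbd2006, Prop. 2.5(i) p.27]: a finite étale covering
`Y` of `𝒢_ℍ` is "split" by a covering `X` pulled back from `𝒢` once the approximator splits the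
constituents of `Y` — i.e. over every constituent, `Y_c × X_c` is a disjoint union of copies of
`X_c` ("this is immediate in the locally trivial case"), so that it can be extended to the whole of
`𝒢` by gluing.  This proof-only file (no definitions) supplies that local step inside ONE connected
anabelioid (Galois category `C` with fibre functor `F`, `Π = Aut F`):

* (from `FreeFibres.lean`: `nonempty_iso_of_equivariant_equiv` — objects with `Π`-equivariantly
  bijective fibres are isomorphic, Mathlib: `functorToAction F` is fully faithful);
* `exists_trivial_card_eq` — "constant" objects: for every `n` an object `D` on whose fibre `Π`
  acts trivially, of fibre cardinality `n`, at EVERY basepoint;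
* `nonempty_iso_prod_of_stabilizer` — **the trivialisation**: if the stabiliser in `Π` of every
  point of `F(X)` acts trivially on `F(Y)`, and `D` is constant with `|F(D)| = |F(Y)|`, then
  `D ⨯ X ≅ Y ⨯ X`;
* small fibre bookkeeping (`fiberBinaryProductEquiv_apply'`, `map_prod_fst_surjective`,
  `trivial_of_iso_fiberFunctor`, `trivial_comp`).

Consumer: `SemiGraphs/CommensurabilityProp25iProofs.lean` ([SemiAnbd] Prop. 2.5 (i)).  Seat
abc-iut-w4-d063 (L3 sub-node (13), abc-iut cell).  Nothing here concerns [IUTchIII] Cor. 3.12.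
-/

namespace Literature.AnabelianGeometry.Anabelioids

open CategoryTheory CategoryTheory.Limits CategoryTheory.PreGaloisCategory

universe u₁ u₂

section

variable {C : Type u₁} [Category.{u₂} C] [GaloisCategory C] (F : C ⥤ FintypeCat.{u₂})
  [FiberFunctor F]

/-- Coordinates of a point of the fibre of a binary product: its two projections.
[cite: SGA1, Exp. V §4] -/
theorem fiberBinaryProductEquiv_apply' {A B : C} (p : F.obj (A ⨯ B)) :
    fiberBinaryProductEquiv F A B p = (F.map prod.fst p, F.map prod.snd p) := by
  obtain ⟨⟨a, b⟩, rfl⟩ := (fiberBinaryProductEquiv F A B).symm.surjective p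
  simp

/-- The `Π`-action on the fibre of a binary product is componentwise.
[cite: SGA1, Exp. V §4] -/
theorem fiberBinaryProductEquiv_smul {A B : C} (σ : Aut F) (p : F.obj (A ⨯ B)) :
    fiberBinaryProductEquiv F A B (σ • p) =
      (σ • (fiberBinaryProductEquiv F A B p).1, σ • (fiberBinaryProductEquiv F A B p).2) := by
  rw [fiberBinaryProductEquiv_apply', fiberBinaryProductEquiv_apply', mulAction_naturality,
    mulAction_naturality]

/-- The `Π`-action on the fibre of a binary product, read through the inverse coordinates.
[cite: SGA1, Exp. V §4] -/
theorem smul_fiberBinaryProductEquiv_symm {A B : C} (σ : Aut F) (a : F.obj A) (b : F.obj B) :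
    σ • (fiberBinaryProductEquiv F A B).symm (a, b) =
      (fiberBinaryProductEquiv F A B).symm (σ • a, σ • b) := by
  apply (fiberBinaryProductEquiv F A B).injective
  rw [fiberBinaryProductEquiv_smul, Equiv.apply_symm_apply, Equiv.apply_symm_apply]

/-- If the fibre of `X` is nonempty, the first projection `Y ⨯ X → Y` is surjective on fibres.
[cite: SGA1, Exp. V §4] -/
theorem map_prod_fst_surjective {Y X : C} (hX : Nonempty (F.obj X)) :
    Function.Surjective (F.map (prod.fst : Y ⨯ X ⟶ Y)) := by
  obtain ⟨x⟩ := hX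
  intro y
  exact ⟨(fiberBinaryProductEquiv F Y X).symm (y, x), fiberBinaryProductEquiv_symm_fst_apply F y x⟩

omit [GaloisCategory C] [FiberFunctor F] in
/-- **The kernel of the fibre action** (a finite étale covering as "an open subgroup of index
`≤ M`", [SemiAnbd] §2 p. 22 / Def. 2.3 (iii)): for an object `S`, the elements of `Π = Aut F`
acting trivially on `F(S)` form an open subgroup of index at most `|F(S)|!`.
[cite: MochizukiSemiAnbd2006, Def. 2.3(iii) p.25] -/
theorem exists_fiberActionKernel (S : C) : ∃ K : Subgroup (Aut F), IsOpen (K : Set (Aut F)) ∧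
    K.index ≤ (Nat.card (F.obj S)).factorial ∧ ∀ τ : Aut F, τ ∈ K ↔ ∀ s : F.obj S, τ • s = s := by
  classical
  let f : Aut F →* Equiv.Perm (F.obj S) := MulAction.toPermHom (Aut F) (F.obj S)
  have hmem : ∀ τ : Aut F, τ ∈ f.ker ↔ ∀ s : F.obj S, τ • s = s := fun τ => by
    rw [MonoidHom.mem_ker, Equiv.ext_iff]
    exact Iff.rfl
  refine ⟨f.ker, ?_, ?_, hmem⟩
  · have hset : (f.ker : Set (Aut F)) = ⋂ s : F.obj S, (MulAction.stabilizer (Aut F) s : Set (Aut F)) := by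
      ext τ
      simp only [SetLike.mem_coe, hmem, Set.mem_iInter, MulAction.mem_stabilizer_iff]
    rw [hset]
    exact isOpen_iInter_of_finite fun s => stabilizer_isOpen (Aut F) s
  · rw [Subgroup.index_ker, ← Nat.card_perm]
    exact Nat.card_le_card_of_injective _ Subtype.val_injective

/-- **Constant objects** (finite sets with trivial `Π`-action, [SGA1] V §4): for every `n` there is
an object `D` of `C` on whose fibre `Π` acts trivially and whose fibre has `n` points — at EVERY
basepoint `F'`. [cite: SGA1, Exp. V Thm. 4.1] -/
theorem exists_trivial_card_eq (n : ℕ) : ∃ D : C,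
    ((∀ (σ : Aut F) (d : F.obj D), σ • d = d) ∧ Nat.card (F.obj D) = n) ∧
      ∀ (F' : C ⥤ FintypeCat.{u₂}) [FiberFunctor F'],
        (∀ (σ : Aut F') (d : F'.obj D), σ • d = d) ∧ Nat.card (F'.obj D) = n := by
  classical
  letI : MulAction (Aut F) (Fin n) :=
    { smul := fun _ i => i, one_smul := fun _ => rfl, mul_smul := fun _ _ _ => rfl }
  have hsm : ∀ (σ : Aut F) (i : Fin n), σ • i = i := fun _ _ => rfl
  have hst : ∀ i : Fin n, IsOpen (MulAction.stabilizer (Aut F) i : Set (Aut F)) := by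
    intro i
    have : (MulAction.stabilizer (Aut F) i : Set (Aut F)) = Set.univ :=
      Set.eq_univ_of_forall fun σ => hsm σ i
    rw [this]
    exact isOpen_univ
  obtain ⟨D, e, he⟩ := exists_obj_fiber_equiv F (Fin n) hst
  have hD : ∀ (σ : Aut F) (d : F.obj D), σ • d = d := fun σ d =>
    e.injective (by rw [he, hsm])
  have hc : Nat.card (F.obj D) = n := by rw [Nat.card_congr e, Nat.card_fin]
  refine ⟨D, ⟨hD, hc⟩, fun F' _ => ?_⟩
  obtain ⟨i⟩ := nonempty_iso_of_fiberFunctor F F'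
  refine ⟨fun σ d => ?_, (card_fiber_eq_of_iso_fiberFunctor i D).symm.trans hc⟩
  obtain ⟨τ, rfl⟩ := i.conjAut.surjective σ
  -- transport `d` back along `i`, act there trivially, transport forward
  have h1 : τ • i.inv.app D d = i.inv.app D d := hD τ _
  rw [mulAction_def] at h1 ⊢
  have h2 := congrArg (i.hom.app D) h1
  rw [Iso.conjAut_hom, Iso.conj_apply]
  simpa [FintypeCat.comp_apply] using h2

omit [GaloisCategory C] [FiberFunctor F] in
/-- A trivial action stays trivial along a change of basepoint `π₁(φ)`: if `Aut (P ⋙ F)` acts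
trivially on the fibre of `S`, so does `Aut F` on the fibre of `P S` (the same finite set).
[cite: MochizukiGeoAn2004, Def. 1.1.2(ii) p.10] -/
theorem trivial_comp {Y : Type*} [Category Y] (P : Y ⥤ C) {S : Y}
    (h : ∀ (σ : Aut (P ⋙ F)) (x : (P ⋙ F).obj S), σ • x = x) :
    ∀ (τ : Aut F) (x : F.obj (P.obj S)), τ • x = x := fun τ x =>
  h (pi1Map P F τ) x

/-- **Constant objects of equal cardinality are isomorphic** (any bijection of fibres with trivial
action is equivariant). [cite: SGA1, Exp. V Thm. 4.1] -/
theorem nonempty_iso_of_trivial {D D' : C} (hD : ∀ (σ : Aut F) (d : F.obj D), σ • d = d)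
    (hD' : ∀ (σ : Aut F) (d : F.obj D'), σ • d = d)
    (hc : Nat.card (F.obj D) = Nat.card (F.obj D')) : Nonempty (D ≅ D') := by
  obtain ⟨e⟩ := Finite.card_eq.mp hc
  exact nonempty_iso_of_equivariant_equiv F e fun σ d => by rw [hD, hD']

/-- **The trivialisation** ([SemiAnbd] proof of Prop. 2.5 (i), p. 27, "this is immediate in the
locally trivial case" / "splits"): if the stabiliser in `Π = Aut F` of every point of `F(X)` acts
trivially on `F(Y)`, and `D` is a constant object with `|F(D)| = |F(Y)|`, then `D ⨯ X ≅ Y ⨯ X`.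
(On fibres: choosing `gₜ ∈ Π` moving a fixed representative of the orbit of `t ∈ F(X)` to `t`,
`(d, t) ↦ (gₜ · e(d), t)` is a `Π`-equivariant bijection `F(D) × F(X) ≃ F(Y) × F(X)`, well defined
because two choices of `gₜ` differ by a stabiliser.) [cite: MochizukiSemiAnbd2006, Prop. 2.5(i) p.27] -/
theorem nonempty_iso_prod_of_stabilizer {D X Y : C}
    (hD : ∀ (σ : Aut F) (d : F.obj D), σ • d = d)
    (hc : Nat.card (F.obj D) = Nat.card (F.obj Y))
    (hst : ∀ (σ : Aut F) (x : F.obj X), σ • x = x → ∀ y : F.obj Y, σ • y = y) :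
    Nonempty (D ⨯ X ≅ Y ⨯ X) := by
  classical
  obtain ⟨e⟩ := Finite.card_eq.mp hc
  -- orbit representatives in `F(X)` and transporters `g t • rep t = t`
  let q : F.obj X → Quotient (MulAction.orbitRel (Aut F) (F.obj X)) := fun t => ⟦t⟧
  let rep : F.obj X → F.obj X := fun t => (q t).out
  have hrep : ∀ t, ∃ g : Aut F, g • rep t = t := fun t => by
    have h : rep t ∈ MulAction.orbit (Aut F) t := by
      change (MulAction.orbitRel (Aut F) (F.obj X)) ((q t).out) t
      exact Quotient.mk_out t
    obtain ⟨g, hg⟩ := h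
    exact ⟨g⁻¹, by rw [← hg, inv_smul_smul]⟩
  choose g hg using hrep
  have hrep_smul : ∀ (k : Aut F) (t : F.obj X), rep (k • t) = rep t := fun k t => by
    change (q (k • t)).out = (q t).out
    rw [show q (k • t) = q t from Quotient.sound ⟨k, rfl⟩]
  -- two transporters differ by an element of a stabiliser, which acts trivially on `F(Y)`
  have key : ∀ (k : Aut F) (t : F.obj X) (y : F.obj Y), g (k • t) • y = (k * g t) • y := by
    intro k t y
    have h1 : ((k * g t)⁻¹ * g (k • t)) • rep t = rep t := by
      rw [mul_smul, inv_smul_eq_iff, ← hrep_smul k t, hg (k • t), hrep_smul k t, mul_smul, hg t]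
    have h2 := hst _ _ h1 y
    rw [mul_smul, inv_smul_eq_iff] at h2
    exact h2
  -- the equivariant bijection of fibres
  let Φ : F.obj D × F.obj X ≃ F.obj Y × F.obj X :=
    { toFun := fun p => (g p.2 • e p.1, p.2)
      invFun := fun p => (e.symm ((g p.2)⁻¹ • p.1), p.2)
      left_inv := fun p => by simp
      right_inv := fun p => by simp }
  have hΦ : ∀ (k : Aut F) (d : F.obj D) (t : F.obj X),
      Φ (k • d, k • t) = (k • (Φ (d, t)).1, k • (Φ (d, t)).2) := by
    intro k d t
    simp only [Φ, Equiv.coe_fn_mk, hD k d, key, mul_smul]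
  let Ψ : F.obj (D ⨯ X) ≃ F.obj (Y ⨯ X) :=
    (fiberBinaryProductEquiv F D X).trans (Φ.trans (fiberBinaryProductEquiv F Y X).symm)
  refine nonempty_iso_of_equivariant_equiv F Ψ fun σ p => ?_
  change (fiberBinaryProductEquiv F Y X).symm (Φ (fiberBinaryProductEquiv F D X (σ • p))) =
    σ • (fiberBinaryProductEquiv F Y X).symm (Φ (fiberBinaryProductEquiv F D X p))
  rw [fiberBinaryProductEquiv_smul, smul_fiberBinaryProductEquiv_symm]
  congr 1
  rw [← hΦ]

end

end Literature.AnabelianGeometry.Anabelioids
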